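import Literature.NumberTheory.EllipticCurves.Rank1Residual.Typed.X10bHeegnerIndexCertificate
import HarnessLib

/-!
# The Cassels–Tate-pairing certificate shape: `Ш[p²] = Ш[p]` + `#Sel^(p) = p^m` ⇒ `#Ш[p^∞] = p^m`
# EXACTLY — a class-free, reduction-type-free consumer (cell `b2b-bsdres`, unit `b2b-bsdres-x10`, gen 8)

HONEST FRAMING (run/shared/lean/b2b/bsd-rank1-residual/, verbatim in every file): the goal of the
cell is to DELETE the COMBINATION-SHAPED residual classes of the Birch–Swinnerton-Dyer formula for
ALL analytic-rank `≤ 1` elliptic curves over `ℚ` — "full BSD formula for every rank `≤ 1` curve in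
class `C`" assembled STRICTLY from published theorems — so that the rank-`≤ 1` remainder becomes
exactly the CONSTRUCTION-SHAPED classes, which are TYPED (missing-input `Prop`s), NOT attempted.
This is not "finishing BSD". Theorems only (no definition, no new named fact); nothing is booked
here; no class label changes (X10b stays CONSTRUCTION-SHAPED, referee R82.3). Per pair.

**What this file adds.** Every rank-`0` residual pair `(E, 3)` of the cell with `#Ш(E/ℚ)_an = 9·unit`
that is still open PER PAIR (X10b `340186p1`; the RESISTANT X4/X6/X7/X8/X11 lists) already carries the
LOWER half as a finite certificate: the two `3`-descent engines give `dim_𝔽₃ Sel^(3)(E/ℚ) = 2`, hence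
`Ш(E/ℚ)[3] ≅ (ℤ/3)²`. What is missing is ONLY an upper bound, and at `p = 3` with small image /
additive / supersingular reduction no published Iwasawa-theoretic or Heegner-index theorem supplies
it (X10-AUDIT.md §§5–13). The cell has therefore chartered (engines RULINGS R-157 / R-164(b) / R-172;
`HOME/b2b-bsdres-x10/g8/ctp-sel3/CHARTER.md`, `FORMAT.md`) a per-pair INSTRUMENT: the Cassels–Tate
pairing on `S^(3)(E/ℚ)` computed by the method of Fisher–Newton (IJNT 10 (2014), Thm. 1.3) with an
independent verifier. By Cassels (J. reine angew. Math. 494 (1998) §1; Fisher–Newton eq. (1)–(2)) the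
kernel of that pairing on `S^(p)` is the image of `S^(p²)`, so a NON-ZERO pairing on a
two-dimensional `S^(3)` means `Ш(E/ℚ)[9] = Ш(E/ℚ)[3]`, i.e. `Ш[3] ∩ 3Ш = 0`. THIS FILE is the kernel
CONSUMER of such a certificate, with the certificate's content taken as the binder
`∀ x : Ш(E/ℚ), p² • x = 0 → p • x = 0` (equivalently `Ш[p] ⊓ pШ = ⊥`,
`shaNoPSqTorsion_iff_torsionBy_inf_range_eq_bot`):
* `primaryComponent_eq_torsionBy_of_sq` — pure group theory: under that hypothesis the `p`-primary
  component of ANY additive commutative group is its `p`-torsion (`Ш[p^∞] = Ш[p]`);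
* `card_sha_inf_torsionBy_eq_card_selmerGroup_of_rankZero` — over any number field: Mordell–Weil
  rank `0` and `p ∤ #E(K)_tors` make `Sel^(p)(E/K) → Ш(E/K)[p]` a BIJECTION (the PROVED fundamental
  exact sequence `selmer_exact_holds`, Mordell–Weil `module_finite_point_holds`), so
  `#Ш(E/K)[p] = #Sel^(p)(E/K)`;
* `card_primaryComponent_sha_eq_of_sq_of_card_selmerGroup` — hence `#Ш(E/K)[p^∞] = #Sel^(p) = p^m`
  EXACTLY, from the two certificates (`#Sel^(p) = p^m`, two descent engines; `Ш[p²] = Ш[p]`, the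
  CTP instrument) — NO Cassels–Tate squareness, NO main conjecture, NO Heegner index, NO image or
  reduction hypothesis;
* `bsdp_of_shaNoPSqTorsion_of_card_selmerGroup` — over `ℚ`, analytic rank `0` (Gross–Zagier–Kolyvagin
  `hGZK` = bsd.S17 gives rank `0` and finiteness) and `ord_p #Ш_an = m` ⇒ Miller's `BSD(E,p)`;
  `padicValNat_shaOrder_eq_of_shaNoPSqTorsion_of_card_selmerGroup` — `ord_p #Ш(E/ℚ) = m`;
* `X10.bsdp_three_rankZero_of_casselsTatePairing_of_card_selmerThree` /
  `X10.missingInputAt_of_casselsTatePairing_of_card_selmerThree` — the X10 instances in the cell's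
  canonical shape (`ClassX10 W 3`: `3 ∤ #E(ℚ)_tors` is derived from `irr(3)`, Mazur), discharging the
  typed input `X10.MissingInputAt W` of `Typed/X10.lean` at such a pair.
Census instance awaiting the instrument: `340186p1 @ 3` (image 3Ns, `r_an = 0`, `#Ш_an = 9`,
`dim Sel₃ = 2` on two engines, `c_2 = c_11 = 3` so no printed Heegner-index bound is sharp —
X10-AUDIT.md §13.1/§13.4; route U2′ of unit x10b reaches it under flag `YZ26@3-BF-ERL-Ohta`); the
instrument's regression vectors are Fisher–Newton §4 (`17127b1`, pairing non-zero) and Creutz,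
Math. Comp. 83 (2014) §8.2 (`15675f1`, `Ш[9] ≅ (ℤ/9)²`, pairing zero). Per curve; NOT a class theorem;
the lane books certificates on the referee's signature.

References: Cassels 1998 §1 [Cassels1998]; Fisher–Newton 2014, (1)–(2), Thm. 1.3 [FisherNewton2014];
Silverman AEC X.4.2 [SilvermanAEC2009]; Miller 2011 Def. 1.1 [Miller2011LMS]; cell files
X10-AUDIT.md §13–§14, HOME/b2b-bsdres-x10/g8/ctp-sel3/{CHARTER,FORMAT}.md, engines RULINGS R-157/R-172.
-/

noncomputable section

open scoped Classical

open WeierstrassCurve Literature.NumberTheory.EllipticCurves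
  Literature.NumberTheory.EllipticCurves.Rank1Residual
  Literature.NumberTheory.EllipticCurves.Rank1Residual.Typed

namespace Summit.BirchSwinnertonDyer.Rank1Residual.X10

/-! ### Group theory: an exponent certificate collapses the `p`-primary part to the `p`-torsion -/

section GroupTheory

variable {A : Type*} [AddCommGroup A]

/-- If `p² • x = 0 ⇒ p • x = 0` for every `x`, then every element killed by a power of `p` is
killed by `p` (descending induction on the exponent). Elementary. [folklore] -/
theorem nsmul_eq_zero_of_pow_nsmul_eq_zero {p : ℕ} (h : ∀ x : A, p ^ 2 • x = 0 → p • x = 0)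
    {k : ℕ} : ∀ {x : A}, p ^ k • x = 0 → p • x = 0 := by
  induction k with
  | zero =>
    intro x hk
    rw [pow_zero, one_smul] at hk
    rw [hk, smul_zero]
  | succ k ih =>
    intro x hk
    have h1 : p ^ k • (p • x) = 0 := by rw [← mul_smul, ← pow_succ, hk]
    have h2 : p • (p • x) = 0 := ih h1
    exact h x (by rw [pow_two, mul_smul]; exact h2)

/-- **`A[p²] = A[p]` ⇒ `A(p) = A[p]`**: under the certificate `∀ x, p² • x = 0 → p • x = 0` the
additive `p`-primary component equals the `p`-torsion subgroup. Elementary. [folklore] -/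
theorem primaryComponent_eq_torsionBy_of_sq {p : ℕ} (h : ∀ x : A, p ^ 2 • x = 0 → p • x = 0) :
    AddCommGroup.primaryComponent A p = AddSubgroup.torsionBy A p := by
  ext x
  rw [AddCommGroup.mem_primaryComponent, AddSubgroup.torsionBy.nsmul_iff]
  constructor
  · rintro ⟨k, hk⟩
    exact nsmul_eq_zero_of_pow_nsmul_eq_zero h hk
  · intro hx
    exact ⟨1, by rwa [pow_one]⟩

/-- Cardinality form of `primaryComponent_eq_torsionBy_of_sq`: `#A(p) = #A[p]`. [folklore] -/
theorem card_primaryComponent_eq_card_torsionBy_of_sq {p : ℕ}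
    (h : ∀ x : A, p ^ 2 • x = 0 → p • x = 0) :
    Nat.card (AddCommGroup.primaryComponent A p) = Nat.card (AddSubgroup.torsionBy A p) := by
  rw [primaryComponent_eq_torsionBy_of_sq h]

/-- The certificate in Cassels' form `A[p] ∩ pA = 0` ("no element of `A[p]` is divisible by `p`")
is equivalent to the exponent form `∀ x, p² • x = 0 → p • x = 0` used in this file. For
`A = Ш(E/K)` the first form is what a non-degenerate Cassels–Tate pairing on `Ш[p]` says (Cassels
1998 §1: the kernel of the pairing on `S^(p)` is the image of `S^(p²)`). The equivalence itself is
elementary. [cite: Cassels1998, §1] [cite: FisherNewton2014, eqs. (1)–(2)] -/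
theorem shaNoPSqTorsion_iff_torsionBy_inf_range_eq_bot {p : ℕ} :
    (∀ x : A, p ^ 2 • x = 0 → p • x = 0) ↔
      AddSubgroup.torsionBy A p ⊓ (nsmulAddMonoidHom (α := A) p).range = ⊥ := by
  constructor
  · intro h
    rw [eq_bot_iff]
    rintro x ⟨hx, ⟨y, rfl⟩⟩
    rw [AddSubgroup.mem_bot]
    have hpy : p • (p • y) = 0 := AddSubgroup.torsionBy.nsmul_iff.mp hx
    have : p ^ 2 • y = 0 := by rw [pow_two, mul_smul]; exact hpy
    exact h y this
  · intro h x hx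
    have hmem : p • x ∈ AddSubgroup.torsionBy A p ⊓ (nsmulAddMonoidHom (α := A) p).range := by
      refine AddSubgroup.mem_inf.mpr ⟨AddSubgroup.torsionBy.nsmul_iff.mpr ?_, ⟨x, rfl⟩⟩
      rw [← mul_smul, ← pow_two]; exact hx
    rw [h, AddSubgroup.mem_bot] at hmem
    exact hmem

variable {B : Type*} [AddCommGroup B]

/-- For a subgroup `S ≤ B`, the `n`-torsion of `S` (as a group) is in bijection with `S ⊓ B[n]`.
Bookkeeping between `Ш[p]` as a subgroup of the type `Ш` and as `Ш ⊓ H¹(K,E)[p]`. [folklore] -/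
theorem card_torsionBy_coe_eq_card_inf (S : AddSubgroup B) (n : ℕ) :
    Nat.card (AddSubgroup.torsionBy S n) = Nat.card ↥(S ⊓ AddSubgroup.torsionBy B n) := by
  refine Nat.card_congr
    { toFun := fun x => ⟨(x.1 : B), AddSubgroup.mem_inf.mpr ⟨x.1.2, ?_⟩⟩
      invFun := fun y => ⟨⟨y.1, (AddSubgroup.mem_inf.mp y.2).1⟩, ?_⟩
      left_inv := fun x => by ext; rfl
      right_inv := fun y => by ext; rfl }
  · have hx : n • x.1 = 0 := AddSubgroup.torsionBy.nsmul_iff.mp x.2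
    refine AddSubgroup.torsionBy.nsmul_iff.mpr ?_
    have := congrArg (Subtype.val : S → B) hx
    simpa only [AddSubgroupClass.coe_nsmul, ZeroMemClass.coe_zero] using this
  · refine AddSubgroup.torsionBy.nsmul_iff.mpr ?_
    apply Subtype.ext
    simpa only [AddSubgroupClass.coe_nsmul, ZeroMemClass.coe_zero] using
      AddSubgroup.torsionBy.nsmul_iff.mp (AddSubgroup.mem_inf.mp y.2).2

end GroupTheory

/-! ### Rank `0`: `Sel^(p)(E/K) ≅ Ш(E/K)[p]` (any number field) -/

section General

variable {K : Type*} [Field K] [NumberField K] (W : WeierstrassCurve K) [W.IsElliptic]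

/-- **Rank `0` and `p ∤ #E(K)_tors` ⇒ `#Ш(E/K)[p] = #Sel^(p)(E/K)`.** Mordell–Weil (tree theorem
`module_finite_point_holds`) and the two side conditions give `pE(K) = E(K)`
(`range_zsmul_eq_top_of_finrank_eq_zero`), so in the PROVED fundamental exact sequence
`0 → E(K)/pE(K) → Sel^(p) → Ш[p] → 0` (`selmer_exact_holds`) the Kummer map vanishes and
`H¹(K,E[p]) → H¹(K,E)` restricted to `Sel^(p)` is injective with image `Ш ⊓ H¹(K,E)[p]`.
[cite: SilvermanAEC2009, Thm X.4.2(a)] -/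
theorem card_sha_inf_torsionBy_eq_card_selmerGroup_of_rankZero (p : ℕ) [hp : Fact p.Prime]
    (hrank : W.mordellWeilRank = 0) (htors : ¬ p ∣ W.torsionOrder) :
    Nat.card ↥(W.sha ⊓ AddSubgroup.torsionBy W.galH1 p) =
      Nat.card (W.selmerGroup (p : ℤ)) := by
  have hp0 : (p : ℤ) ≠ 0 := by exact_mod_cast hp.out.ne_zero
  obtain ⟨κ, hker, hrange, hmap⟩ := selmer_exact_holds W (p : ℤ) hp0
  haveI : Module.Finite ℤ W.toAffine.Point := W.module_finite_point_holds
  -- no rational `p`-torsion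
  have htorsBy : AddSubgroup.torsionBy W.toAffine.Point (p : ℤ) = ⊥ := by
    rw [eq_bot_iff]
    intro P hP
    rw [AddSubgroup.mem_bot]
    by_contra hP0
    have hpP : p • P = 0 := AddSubgroup.torsionBy.nsmul_iff.mp hP
    have hord : addOrderOf P = p := addOrderOf_eq_prime hpP hP0
    have hfin : IsOfFinAddOrder P := by
      rw [← addOrderOf_pos_iff, hord]; exact hp.out.pos
    have hmemT : P ∈ AddCommGroup.torsion W.toAffine.Point := by
      rw [AddCommGroup.mem_torsion]; exact hfin
    have hordT : addOrderOf (⟨P, hmemT⟩ : AddCommGroup.torsion W.toAffine.Point) = p := by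
      rw [← AddSubgroup.addOrderOf_coe]; exact hord
    apply htors
    have := addOrderOf_dvd_natCard (⟨P, hmemT⟩ : AddCommGroup.torsion W.toAffine.Point)
    rw [hordT] at this
    exact this
  have hfinrank : Module.finrank ℤ W.toAffine.Point = 0 := hrank
  have htop := range_zsmul_eq_top_of_finrank_eq_zero (A := W.toAffine.Point) htorsBy hfinrank
  -- the Kummer map vanishes, so `Sel ⊓ ker = ⊥`
  have hκ0 : κ.range = ⊥ := by
    rw [eq_bot_iff]
    rintro _ ⟨P, rfl⟩
    rw [AddSubgroup.mem_bot, ← AddMonoidHom.mem_ker, hker, htop]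
    exact AddSubgroup.mem_top P
  have hinf : W.selmerGroup (p : ℤ) ⊓ (W.torsionH1ToH1 (p : ℤ)).ker = ⊥ := by
    rw [← hrange, hκ0]
  -- restrict `H¹(K,E[p]) → H¹(K,E)` to `Sel^(p)`: injective with range `Ш ⊓ H¹(K,E)[p]`
  set T : W.selmerGroup (p : ℤ) →+ W.galH1 :=
    (W.torsionH1ToH1 (p : ℤ)).comp (W.selmerGroup (p : ℤ)).subtype with hT
  have hTinj : Function.Injective T := by
    rw [injective_iff_map_eq_zero]
    intro c hc
    have hc' : (c : W.galH1Torsion (p : ℤ)) ∈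
        W.selmerGroup (p : ℤ) ⊓ (W.torsionH1ToH1 (p : ℤ)).ker :=
      AddSubgroup.mem_inf.mpr ⟨c.2, (AddMonoidHom.mem_ker).mpr hc⟩
    rw [hinf, AddSubgroup.mem_bot] at hc'
    exact Subtype.ext hc'
  have hTrange : T.range = (W.selmerGroup (p : ℤ)).map (W.torsionH1ToH1 (p : ℤ)) := by
    rw [hT, AddMonoidHom.range_comp, AddSubgroup.range_subtype]
  rw [← hmap, ← hTrange]
  exact Nat.card_congr (AddMonoidHom.ofInjective hTinj).toEquiv.symm

/-- **The two finite certificates give the `p`-part EXACTLY: `#Ш(E/K)[p^∞] = p^m`.** Rank `0`,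
`p ∤ #E(K)_tors`, the descent certificate `#Sel^(p)(E/K) = p^m` and the Cassels–Tate-pairing
certificate `Ш[p²] = Ш[p]` (`∀ x, p² • x = 0 → p • x = 0`). No finiteness of `Ш` assumed; no
published `p`-part theorem enters. [cite: SilvermanAEC2009, Thm X.4.2(a)] -/
theorem card_primaryComponent_sha_eq_of_sq_of_card_selmerGroup (p : ℕ) [Fact p.Prime]
    (hrank : W.mordellWeilRank = 0) (htors : ¬ p ∣ W.torsionOrder)
    (hsq : ∀ x : W.sha, p ^ 2 • x = 0 → p • x = 0) {m : ℕ}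
    (hcard : Nat.card (W.selmerGroup (p : ℤ)) = p ^ m) :
    Nat.card (AddCommGroup.primaryComponent W.sha p) = p ^ m := by
  rw [card_primaryComponent_eq_card_torsionBy_of_sq hsq, card_torsionBy_coe_eq_card_inf,
    card_sha_inf_torsionBy_eq_card_selmerGroup_of_rankZero W p hrank htors, hcard]

end General

/-! ### Over `ℚ`: Miller's `BSD(E,p)` from the two certificates -/

section OverQ

variable (W : WeierstrassCurve ℚ) [W.IsElliptic] (p : ℕ) [Fact p.Prime]

/-- **`BSD(E,p)` at a rank-`0` pair from the `p`-descent and Cassels–Tate-pairing certificates.**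
For `E/ℚ` of analytic rank `0` (Gross–Zagier–Kolyvagin `hGZK` = bsd.S17: rank `0`, `Ш` finite) with
`p ∤ #E(ℚ)_tors`, `#Sel^(p)(E/ℚ) = p^m`, `Ш(E/ℚ)[p²] = Ш(E/ℚ)[p]` and `#Ш(E/ℚ)_an = q` with
`ord_p q = m`, Miller's `BSD(E,p)` holds — `#Ш(E/ℚ)[p^∞] = p^m` exactly
(`card_primaryComponent_sha_eq_of_sq_of_card_selmerGroup`). Class-free and reduction-type-free:
the intended consumer of the cell's CTP-on-Sel^(3) instrument (`m = 2`, `p = 3`) on X10b / X4 /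
X6–X8 / X11 rank-`0` pairs with `#Ш_an = 9`. Per curve; NOT a class theorem.
[cite: Miller2011LMS, §1 and Def. 1.1] [cite: SilvermanAEC2009, Thm X.4.2(a)]
[cite: FisherNewton2014, Thm. 1.3 and eqs. (1)–(2)] -/
theorem bsdp_of_shaNoPSqTorsion_of_card_selmerGroup
    (hGZK : rank_eq_analyticRank_of_analyticRank_le_one) (hr : W.analyticRank = 0)
    (htors : ¬ p ∣ W.torsionOrder) {m : ℕ} (hcard : Nat.card (W.selmerGroup (p : ℤ)) = p ^ m)
    (hsq : ∀ x : W.sha, p ^ 2 • x = 0 → p • x = 0)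
    {q : ℚ} (hq : shaAn W = (q : ℂ)) (hv : padicValRat p q = m) : BSDp W p := by
  have hr1 : W.analyticRank ≤ 1 := by rw [hr]; norm_num
  obtain ⟨hrank', hfin⟩ := hGZK W hr1
  have hrank : W.mordellWeilRank = 0 := by rw [hrank', hr]
  haveI : Finite W.sha := hfin
  refine ⟨hrank', Finite.of_injective _ Subtype.val_injective, q, hq, ?_⟩
  rw [card_primaryComponent_sha_eq_of_sq_of_card_selmerGroup W p hrank htors hsq hcard,
    padicValNat.prime_pow, hv]

/-- **The exact `p`-part on such a pair: `ord_p #Ш(E/ℚ) = m`.** [cite: SilvermanAEC2009, Thm X.4.2(a)] -/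
theorem padicValNat_shaOrder_eq_of_shaNoPSqTorsion_of_card_selmerGroup
    (hGZK : rank_eq_analyticRank_of_analyticRank_le_one) (hr : W.analyticRank = 0)
    (htors : ¬ p ∣ W.torsionOrder) {m : ℕ} (hcard : Nat.card (W.selmerGroup (p : ℤ)) = p ^ m)
    (hsq : ∀ x : W.sha, p ^ 2 • x = 0 → p • x = 0) : padicValNat p W.shaOrder = m := by
  have hr1 : W.analyticRank ≤ 1 := by rw [hr]; norm_num
  obtain ⟨hrank', hfin⟩ := hGZK W hr1
  have hrank : W.mordellWeilRank = 0 := by rw [hrank', hr]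
  haveI : Finite W.sha := hfin
  rw [WeierstrassCurve.shaOrder, ← padicValNat_card_addPrimaryComponent (A := W.sha) p,
    card_primaryComponent_sha_eq_of_sq_of_card_selmerGroup W p hrank htors hsq hcard,
    padicValNat.prime_pow]

/-- The typed OUTPUT `MissingPPartAt W p` of `Typed/Basic.lean` at such a pair (both halves at
once). Bookkeeping. [cite: Miller2011LMS, Def. 1.1] -/
theorem missingPPartAt_of_shaNoPSqTorsion_of_card_selmerGroup
    (hGZK : rank_eq_analyticRank_of_analyticRank_le_one) (hr : W.analyticRank = 0)
    (htors : ¬ p ∣ W.torsionOrder) {m : ℕ} (hcard : Nat.card (W.selmerGroup (p : ℤ)) = p ^ m)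
    (hsq : ∀ x : W.sha, p ^ 2 • x = 0 → p • x = 0)
    {q : ℚ} (hq : shaAn W = (q : ℂ)) (hv : padicValRat p q = m) : MissingPPartAt W p := by
  have hr1 : W.analyticRank ≤ 1 := by rw [hr]; norm_num
  haveI : Finite W.sha := (hGZK W hr1).2
  exact missingPPartAt_of_bsdp W p
    (bsdp_of_shaNoPSqTorsion_of_card_selmerGroup W p hGZK hr htors hcard hsq hq hv)

end OverQ

/-! ### Class X10 at `p = 3`, rank `0` (`340186p1` and the RESISTANT list, certificate shape) -/

section X10

variable (W : WeierstrassCurve ℚ) [W.IsElliptic] [W.IsGloballyMinimal]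

/-- `irr(3)` ⇒ `3 ∤ #E(ℚ)_tors` (Mazur / the tree's `padicValNat_torsionOrder_eq_zero_of_irreducible`),
packaged for the X10 instances. [cite: Miller2011LMS, §1] -/
theorem not_three_dvd_torsionOrder_of_classX10 (hX : ClassX10 W 3) : ¬ 3 ∣ W.torsionOrder := by
  intro hd
  have h0 := padicValNat_torsionOrder_eq_zero_of_irreducible W 3 hX.2.2.1
  rw [padicValNat.eq_zero_iff] at h0
  rcases h0 with h | h | h
  · exact absurd h (by norm_num)
  · exact absurd h W.torsionOrder_pos_holds.ne'
  · exact h hd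

/-- **X10 ∧ `r = 0`: `BSD(E,3)` from Gross–Zagier–Kolyvagin plus the two finite certificates**
`#Sel^(3)(E/ℚ) = 3^m` (exact `3`-descent, two engines) and `Ш(E/ℚ)[9] = Ш(E/ℚ)[3]` (the
Cassels–Tate pairing on `S^(3)` is non-degenerate — the chartered CTP instrument), at a pair with
`ord_3 #Ш_an = m`. NO Cassels–Tate squareness, NO main conjecture, NO Heegner index, NO image
hypothesis beyond `irr(3) ∈ ClassX10` (used only for `3 ∤ #E(ℚ)_tors`). Census instance: `340186p1`
(`m = 2`; X10-AUDIT.md §13–§14) once its certificate exists. Per curve; NOT a class theorem; the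
lane books. [cite: Miller2011LMS, §1 and Def. 1.1] [cite: SilvermanAEC2009, Thm X.4.2(a)] -/
theorem bsdp_three_rankZero_of_casselsTatePairing_of_card_selmerThree
    (hGZK : rank_eq_analyticRank_of_analyticRank_le_one) (hX : ClassX10 W 3)
    (hr : W.analyticRank = 0) {m : ℕ} (hcard : Nat.card (W.selmerGroup (3 : ℤ)) = 3 ^ m)
    (h9 : ∀ x : W.sha, 9 • x = 0 → 3 • x = 0)
    {q : ℚ} (hq : shaAn W = (q : ℂ)) (hv : padicValRat 3 q = m) : BSDp W 3 :=
  bsdp_of_shaNoPSqTorsion_of_card_selmerGroup W 3 hGZK hr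
    (not_three_dvd_torsionOrder_of_classX10 W hX) (by exact_mod_cast hcard)
    (fun x hx => h9 x (by simpa using hx)) hq hv

/-- The exact `3`-part on such an X10 pair: `ord_3 #Ш(E/ℚ) = m` (for `340186p1`: `#Ш[3^∞] = 9`).
[cite: SilvermanAEC2009, Thm X.4.2(a)] -/
theorem padicValNat_shaOrder_three_of_casselsTatePairing_of_card_selmerThree
    (hGZK : rank_eq_analyticRank_of_analyticRank_le_one) (hX : ClassX10 W 3)
    (hr : W.analyticRank = 0) {m : ℕ} (hcard : Nat.card (W.selmerGroup (3 : ℤ)) = 3 ^ m)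
    (h9 : ∀ x : W.sha, 9 • x = 0 → 3 • x = 0) : padicValNat 3 W.shaOrder = m :=
  padicValNat_shaOrder_eq_of_shaNoPSqTorsion_of_card_selmerGroup W 3 hGZK hr
    (not_three_dvd_torsionOrder_of_classX10 W hX) (by exact_mod_cast hcard)
    (fun x hx => h9 x (by simpa using hx))

/-- **Discharging the typed missing input of `Typed/X10.lean`** at such a pair: the two certificates
give `X10.MissingInputAt W` — on an X10b pair carrying them nothing is missing. Bookkeeping.
[cite: Miller2011LMS, Def. 1.1] -/
theorem missingInputAt_of_casselsTatePairing_of_card_selmerThree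
    (hGZK : rank_eq_analyticRank_of_analyticRank_le_one) (hX : ClassX10 W 3)
    (hr : W.analyticRank = 0) {m : ℕ} (hcard : Nat.card (W.selmerGroup (3 : ℤ)) = 3 ^ m)
    (h9 : ∀ x : W.sha, 9 • x = 0 → 3 • x = 0)
    {q : ℚ} (hq : shaAn W = (q : ℂ)) (hv : padicValRat 3 q = m) : X10.MissingInputAt W := fun _ =>
  haveI : Finite W.sha := (hGZK W hX.analyticRank_le_one).2
  missingPPartAt_of_bsdp W 3
    (bsdp_three_rankZero_of_casselsTatePairing_of_card_selmerThree W hGZK hX hr hcard h9 hq hv)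

end X10

end Summit.BirchSwinnertonDyer.Rank1Residual.X10

end
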